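import Mathlib
import Summits.AtomisticToContinuum.HydrodynamicLimit.Theses.CollisionIsometryCLT

/-!
# Crux `DiffuseBackwardInfluence` (stmt-AtomisticToContinuum-12950) — crux-ideate round 1, ideator 2

Typed first lemmas of the two idea cards of this seat:

* §1 card `gram-coherence-cascade` — the Gram-shape potential `Φ = Σ_{i,k} ‖M_ik M_ikᵀ‖_F²`, its
  EXACT jump at a collision (all gain carried by the pre-contact cross-Gram `C = M_ik M_jkᵀ`),
  monotonicity when `C = 0` for ARBITRARY normals, the per-source conservation law
  `Σ_i ‖S_ik‖² + Σ_{i≠j} ‖C^{ij}_k‖² = 3` (PROVED), and the typed statistical target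
  `CoherenceSubordination` over the crux's own frozen-geometry transfer.
* §2 card `right-angle-rigidity` — every frozen-geometry collision is the Householder reflection of
  `(ℝ³)^{N+1}` along the root `e_i ⊗ ω − e_j ⊗ ω` (PROVED), inner products of two roots (PROVED), the
  arithmetic step "cos θ / 2 a large-rank Coxeter cosine ⇒ θ ∈ {0, 90°, 180°}" (PROVED), and the
  typed classification facts `DihedralFiniteRational`, `LargeRankRootCosines` (cited, unproved).

Nothing here restates or weakens the crux; the crux decl is
`Summit.AtomisticToContinuum.HydrodynamicLimit.Theses.CollisionIsometryCLT.DiffuseBackwardInfluence`.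
§0 copies the crux's `let M` with the step count made explicit (same text as the crux, and as
`IdeatorOneG2Sketch.lean` §0, so that the two seats' objects agree definitionally).
-/

namespace Summit.AtomisticToContinuum.HydrodynamicLimit.Cruxes.DiffuseBackwardInfluence.IdeatorTwo

open scoped BigOperators InnerProductSpace ENNReal
open MeasureTheory Filter Topology Set

noncomputable section

/-- Velocity space. -/
abbrev V3 : Type := EuclideanSpace ℝ (Fin 3)

/-- Torus phase space of `N + 1` spheres. -/
abbrev Cfg (N : ℕ) : Type :=
  Literature.Analysis.FluidPDE.Config (N + 1) (Fin 3) (UnitAddTorus (Fin 3))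

/-! ## §0 The transfer after `n` collisions (the crux's `let M`, step count made explicit) -/

section Transfer

variable (σ : ℝ) (N : ℕ)

/-- Pre-collisional configuration of the `n`-th collision of the Alexander dynamics started at `y`
(the crux's `pre k`). -/
def pre (y : Cfg N) (n : ℕ) : Cfg N :=
  let G := Literature.Analysis.FluidPDE.Torus.geometry (Fin 3)
  let ε : ℝ := Literature.MathematicalPhysics.KineticTheory.hsDiameter σ N
  let zk := Literature.Analysis.FluidPDE.Alexander.stateAfter G ε y n
  Literature.Analysis.FluidPDE.freeFlight G
    (Literature.Analysis.FluidPDE.Alexander.freeExitTime G ε zk).toReal zk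

/-- The frozen-geometry velocity transfer after the first `n` collisions (the crux's `M N y Δ` is
`transferN σ N y (collisionCount … y Δ)`). -/
def transferN (y : Cfg N) (n : ℕ) (W : Fin (N + 1) → V3) : Fin (N + 1) → V3 :=
  let G := Literature.Analysis.FluidPDE.Torus.geometry (Fin 3)
  let ε : ℝ := Literature.MathematicalPhysics.KineticTheory.hsDiameter σ N
  (List.range n).foldl
    (fun W' k =>
      @dite (Fin (N + 1) → V3)
        (Literature.Analysis.FluidPDE.Alexander.incomingPairs G ε (pre σ N y k)).Nonempty
        (Classical.propDecidable _)
        (fun h => fun i =>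
          (Literature.Analysis.FluidPDE.collidePair G h.some.1 h.some.2
            (fun j => ((pre σ N y k j).1, W' j)) i).2)
        (fun _ => W'))
    W

/-- Number of collisions of the Alexander dynamics from `y` in the window `[0, Δ]`. -/
def stepCount (y : Cfg N) (Δ : ℝ) : ℕ :=
  Literature.Analysis.FluidPDE.Alexander.collisionCount
    (Literature.Analysis.FluidPDE.Torus.geometry (Fin 3))
    (Literature.MathematicalPhysics.KineticTheory.hsDiameter σ N) y Δ

/-- The three columns of the block `M_ik` after `n` collisions (`a ↦ M_ik e_a ∈ V3`). -/
def blockCols (y : Cfg N) (n : ℕ) (i k : Fin (N + 1)) : Fin 3 → V3 :=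
  fun a => transferN σ N y n (Pi.single k (EuclideanSpace.single a (1 : ℝ))) i

/-- The colliding pair of the `n`-th collision (`none` on the null set with no incoming pair). -/
def stepPair (y : Cfg N) (n : ℕ) : Option (Fin (N + 1) × Fin (N + 1)) :=
  let G := Literature.Analysis.FluidPDE.Torus.geometry (Fin 3)
  let ε : ℝ := Literature.MathematicalPhysics.KineticTheory.hsDiameter σ N
  @dite (Option (Fin (N + 1) × Fin (N + 1)))
    (Literature.Analysis.FluidPDE.Alexander.incomingPairs G ε (pre σ N y n)).Nonempty
    (Classical.propDecidable _) (fun h => some h.some) (fun _ => none)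

/-- The unit normal of the `n`-th collision (minimal-image separation direction; `0` as junk). -/
def stepNormal (y : Cfg N) (n : ℕ) : V3 :=
  match stepPair σ N y n with
  | some p =>
      let s := (Literature.Analysis.FluidPDE.Torus.geometry (Fin 3)).sepVec
        ((pre σ N y n) p.1).1 ((pre σ N y n) p.2).1
      ‖s‖⁻¹ • s
  | none => 0

end Transfer

/-! ## §1 Card `gram-coherence-cascade`: the Gram-shape potential and its exact jump -/

section Gram

/-- Component of `v` orthogonal to the unit vector `ω`: `(I − ωωᵀ) v`. -/
def offPart (ω v : V3) : V3 := v - ⟪ω, v⟫_ℝ • ω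

/-- For a block given by its three columns `u a = M e_a`: the vector `S ω = M Mᵀ ω = Σ_a ⟪ω, u_a⟫ u_a`
(`S = M Mᵀ` is the Gram block; `⟪ω, S ω⟫` is the SHARE handed over along `ω`). -/
def gramVec (u : Fin 3 → V3) (ω : V3) : V3 := ∑ a, ⟪ω, u a⟫_ℝ • u a

/-- For two blocks `u` (columns of `M_ik`) and `w` (columns of `M_jk`): the vector
`C ω = M_ik M_jkᵀ ω = Σ_a ⟪ω, w_a⟫ u_a`, `C = M_ik M_jkᵀ` the pre-contact CROSS-GRAM (coherence) of the
two rows at source `k`; `crossVec w u ω = Cᵀ ω`. -/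
def crossVec (u w : Fin 3 → V3) (ω : V3) : V3 := ∑ a, ⟪ω, w a⟫_ℝ • u a

/-- `‖M Mᵀ‖_F² = ‖Mᵀ M‖_F² = Σ_{a,b} ⟪u_a, u_b⟫²`: squared Frobenius norm of the Gram block. -/
def gramFrob2 (u : Fin 3 → V3) : ℝ := ∑ a, ∑ b, ⟪u a, u b⟫_ℝ ^ 2

/-- Block mass `‖M‖_F² = tr S = Σ_a ‖u_a‖²` (the crux's `a_ik`; `ipr_i = Σ_k (tr S_ik)²`). -/
def blockMass (u : Fin 3 → V3) : ℝ := ∑ a, ‖u a‖ ^ 2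

/-- The collision update of the pair of blocks at one source: particle `i` keeps the part of its
block orthogonal to `ω` and receives the `ω`-part of `j`'s block: `M_ik' = (I−P)M_ik + P M_jk`,
columnwise. The partner's new block is `blockUpdate ω w u`. -/
def blockUpdate (ω : V3) (u w : Fin 3 → V3) : Fin 3 → V3 :=
  fun a => offPart ω (u a) + ⟪ω, w a⟫_ℝ • ω

/-- **Exact jump of the Gram-shape potential** (card `gram-coherence-cascade`, first lemma; verified
numerically to `5·10⁻¹³` on 2000 random instances, `py/gram_check.py`): at a collision with unit
normal `ω`, for every source `k`,
`‖S_i'‖² + ‖S_j'‖² − ‖S_i‖² − ‖S_j‖² = −2(‖(I−P)S_iω‖² + ‖(I−P)S_jω‖²) + 2(‖(I−P)Cω‖² + ‖(I−P)Cᵀω‖²)`: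
dissipation is the off-diagonal (w.r.t. `ω ⊕ ω^⊥`) weight of the two Gram blocks, and ALL gain is
carried by the pre-contact cross-Gram `C = M_ik M_jkᵀ`. Proof on paper: the `6×6` Gram of the
stacked pair is conjugated by the orthogonal involution `[[I−P, P],[P, I−P]]`, its Frobenius norm
is invariant, and the new off-diagonal block splits into four mutually orthogonal pieces
`(I−P)S_iP + (I−P)C(I−P) + PCᵀP + PS_j(I−P)`. -/
def GramJumpIdentity : Prop :=
  ∀ (ω : V3) (u w : Fin 3 → V3), ‖ω‖ = 1 →
    gramFrob2 (blockUpdate ω u w) + gramFrob2 (blockUpdate ω w u) - (gramFrob2 u + gramFrob2 w) =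
      -2 * (‖offPart ω (gramVec u ω)‖ ^ 2 + ‖offPart ω (gramVec w ω)‖ ^ 2) +
        2 * (‖offPart ω (crossVec u w ω)‖ ^ 2 + ‖offPart ω (crossVec w u ω)‖ ^ 2)

/-- **Coherence-free contacts are dissipative for arbitrary normals** (corollary of
`GramJumpIdentity`): if the pre-contact cross-Gram vanishes (`C = M_ik M_jkᵀ = 0`, i.e.
`Σ_a ⟪v, w_a⟫ u_a = 0` for all `v`) — which holds on forests, but ALSO at the immediate recollision
of a fresh pair (blocks `I−P₁ ∣ P₁`, where `Σ_k a_k²` rises by `12/45` per shared source on average,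
barrier note N5) — then `Φ` does not increase, whatever `ω` is. -/
def CrossFreeMonotone : Prop :=
  ∀ (ω : V3) (u w : Fin 3 → V3), ‖ω‖ = 1 → (∀ v : V3, crossVec u w v = 0) →
    gramFrob2 (blockUpdate ω u w) + gramFrob2 (blockUpdate ω w u) ≤ gramFrob2 u + gramFrob2 w

/-- Mass is a lower bound for shape: `(tr S)² ≤ 3 ‖S‖_F²`, i.e. `ipr_i ≤ 3 Φ_i` blockwise
(Cauchy–Schwarz on the three eigenvalues); so `Φ/(N+1) → 0` in mean implies the crux. -/
def MassLeShape : Prop :=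
  ∀ u : Fin 3 → V3, blockMass u ^ 2 ≤ 3 * gramFrob2 u

/-- **Per-source conservation law** (PROVED below): if the block column `(M_ik)_i` of the orthogonal
transfer has orthonormal columns (`Σ_i ⟪M_ik e_a, M_ik e_b⟫ = δ_ab`, i.e. `Mᵀ M = I` restricted to
source `k`), then the big Gram `G^k = M_{·k} M_{·k}ᵀ` is a rank-3 projection and
`Σ_i Σ_j ‖M_ik M_jkᵀ‖_F² = 3`: diagonal Gram weight `Φ_k = Σ_i ‖S_ik‖²` plus total pair coherence
`Ψ_k = Σ_{i≠j} ‖C^{ij}_k‖²` is CONSERVED (`= 3`). Delocalisation of source `k` = transfer of the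
conserved Gram weight from the diagonal to pair coherences. -/
theorem gram_conservation {n : ℕ} (u : Fin n → Fin 3 → V3)
    (horth : ∀ a b : Fin 3, ∑ i, ⟪u i a, u i b⟫_ℝ = if a = b then 1 else 0) :
    ∑ i, ∑ j, ∑ a, ∑ b, ⟪u i a, u i b⟫_ℝ * ⟪u j b, u j a⟫_ℝ = 3 := by
  -- expand the two inner `Fin 3` sums, split, factor, and evaluate with `horth`
  simp only [Fin.sum_univ_three, Finset.sum_add_distrib, ← Finset.mul_sum, ← Finset.sum_mul, horth]
  have h02 : ((0 : Fin 3) = 2) = False := by decide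
  have h12 : ((1 : Fin 3) = 2) = False := by decide
  have h20 : ((2 : Fin 3) = 0) = False := by decide
  have h21 : ((2 : Fin 3) = 1) = False := by decide
  simp only [h02, h12, h20, h21, if_false]
  norm_num

/-! ### The typed statistical target over the crux's transfer -/

section Target

variable (σ : ℝ) (N : ℕ)

/-- Φ-dissipation of the `n`-th collision (pre-collision blocks = `transferN … n`, normal `ω_n`):
`2 Σ_k (‖(I−P)S_{ik}ω‖² + ‖(I−P)S_{jk}ω‖²)`; `0` on the null no-pair set. -/
def stepDiss (y : Cfg N) (n : ℕ) : ℝ :=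
  match stepPair σ N y n with
  | some p =>
      let ω := stepNormal σ N y n
      2 * ∑ k : Fin (N + 1),
        (‖offPart ω (gramVec (blockCols σ N y n p.1 k) ω)‖ ^ 2 +
          ‖offPart ω (gramVec (blockCols σ N y n p.2 k) ω)‖ ^ 2)
  | none => 0

/-- Φ-gain of the `n`-th collision: `2 Σ_k (‖(I−P)C^{ij}_k ω‖² + ‖(I−P)C^{ji}_k ω‖²)`, the cashed
pre-contact coherence of the colliding pair. -/
def stepGain (y : Cfg N) (n : ℕ) : ℝ :=
  match stepPair σ N y n with
  | some p =>
      let ω := stepNormal σ N y n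
      2 * ∑ k : Fin (N + 1),
        (‖offPart ω (crossVec (blockCols σ N y n p.1 k) (blockCols σ N y n p.2 k) ω)‖ ^ 2 +
          ‖offPart ω (crossVec (blockCols σ N y n p.2 k) (blockCols σ N y n p.1 k) ω)‖ ^ 2)
  | none => 0

/-- Cumulative dissipation over the first `L` collisions. -/
def cumDiss (y : Cfg N) (L : ℕ) : ℝ := ∑ n ∈ Finset.range L, stepDiss σ N y n

/-- Cumulative cashed coherence over the first `L` collisions. -/
def cumGain (y : Cfg N) (L : ℕ) : ℝ := ∑ n ∈ Finset.range L, stepGain σ N y n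

/-- Total Gram-shape potential after `L` collisions: `Φ(L) = Σ_i Σ_k ‖S_ik(L)‖_F²` (`= 3(N+1)` at
`L = 0`, `≥ (N+1)·ipr/3` always). -/
def gramPotential (y : Cfg N) (L : ℕ) : ℝ :=
  ∑ i : Fin (N + 1), ∑ k : Fin (N + 1), gramFrob2 (blockCols σ N y L i k)

end Target

/-- **Telescoping** (bookkeeping target; from `GramJumpIdentity` by induction on the Alexander step,
each step changing only the colliding pair's rows): `Φ(L) = 3(N+1) − cumDiss(L) + cumGain(L)`. -/
def PhiTelescopes : Prop :=
  ∀ (σ : ℝ) (N : ℕ) (y : Cfg N) (L : ℕ), 0 < σ → σ < 2⁻¹ →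
    gramPotential σ N y L = 3 * ((N + 1 : ℕ) : ℝ) - cumDiss σ N y L + cumGain σ N y L

/-- **COHERENCE SUBORDINATION** — the statistical target of card `gram-coherence-cascade` (the one
genuinely new dynamical statement of the line; hardest): along the non-equilibrium local-Gibbs
evolution, on every admissible window the coherence cashed at contacts is a FIXED FRACTION short of
the dissipation, up to `o(N)`: for some `η ∈ (0,1)`,
`E_LG[(N+1)⁻¹ (cumGain − (1−η)·cumDiss)₊] → 0`. (Loschmidt echoes are exactly `cumGain = cumDiss`;
the Kac walk has `cumGain/cumDiss ≈ 0–0.2` before the Haar floor, and `≤ 0.85` even when 80 % of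
collisions are forced recollisions with the last three partners, `py/gd.py`.) -/
def CoherenceSubordination : Prop :=
  ∀ (a₀ θ₀ : UnitAddTorus (Fin 3) → ℝ) (u₀ : UnitAddTorus (Fin 3) → V3),
    Continuous a₀ → Continuous θ₀ → Continuous u₀ → (∀ x, 0 < a₀ x) → (∀ x, 0 < θ₀ x) →
    ∃ σ₀ : ℝ, 0 < σ₀ ∧ ∀ σ : ℝ, 0 < σ → σ < σ₀ → ∃ η : ℝ, 0 < η ∧ η < 1 ∧
      ∀ Φ : (N : ℕ) → Literature.Analysis.FluidPDE.HardSphereFlow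
          (Literature.Analysis.FluidPDE.Torus.geometry (Fin 3))
          (Literature.MathematicalPhysics.KineticTheory.hsDiameter σ N) (N + 1),
      ∀ Δ : ℕ → ℝ, (∀ N, 0 < Δ N) → Tendsto Δ atTop (𝓝 0) →
        Tendsto (fun N : ℕ => Δ N * ((N + 1 : ℕ) : ℝ) ^ ((1 : ℝ) / 3)) atTop atTop →
        ∀ t : ℝ, 0 < t →
          Tendsto (fun N : ℕ =>
            ∫⁻ z, ENNReal.ofReal (((N + 1 : ℕ) : ℝ)⁻¹ *
              max 0 (cumGain σ N ((Φ N).flow (t - Δ N) z) (stepCount σ N ((Φ N).flow (t - Δ N) z) (Δ N))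
                - (1 - η) * cumDiss σ N ((Φ N).flow (t - Δ N) z)
                    (stepCount σ N ((Φ N).flow (t - Δ N) z) (Δ N))))
              ∂(Literature.MathematicalPhysics.KineticTheory.localGibbsLaw σ a₀ u₀ θ₀ N (Φ N)))
            atTop (𝓝 0)

end Gram

/-! ## §2 Card `right-angle-rigidity`: the transfer is an element of a reflection group -/

section Reflection

/-- The ROOT of the collision `(i, j, ω)`: the field `e_i ⊗ ω − e_j ⊗ ω` on `n` particles
(squared norm `2` for a unit normal). -/
def root {n : ℕ} (i j : Fin n) (ω : V3) : Fin n → V3 := Pi.single i ω - Pi.single j ω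

/-- Euclidean inner product on velocity fields `(ℝ³)ⁿ`. -/
def bigInner {n : ℕ} (W W' : Fin n → V3) : ℝ := ∑ m, ⟪W m, W' m⟫_ℝ

/-- **Every frozen-geometry collision is a Householder reflection** (card `right-angle-rigidity`,
first lemma, PROVED): for a unit normal `ω` and `i ≠ j`, replacing `(W_i, W_j)` by
`reflectVel ω (W_i, W_j)` is `W ↦ W − ⟪ω, W_i − W_j⟫ (e_i ⊗ ω − e_j ⊗ ω) = W − 2 (⟪u,W⟫/⟪u,u⟫) u`
with `u = root i j ω`; hence the window transfer `M` is a word in reflections and lies in the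
reflection group generated by the realised roots. -/
theorem collision_eq_householder {n : ℕ} {i j : Fin n} (hij : i ≠ j) (ω : V3) (hω : ‖ω‖ = 1)
    (W : Fin n → V3) :
    Function.update (Function.update W i
        (Literature.Analysis.FluidPDE.reflectVel ω (W i, W j)).1) j
        (Literature.Analysis.FluidPDE.reflectVel ω (W i, W j)).2 =
      W - ⟪W i - W j, ω⟫_ℝ • root i j ω := by
  funext m
  by_cases hmj : m = j
  · subst hmj
    simp [Literature.Analysis.FluidPDE.reflectVel, hω, root, Pi.single_apply, hij.symm]
  · by_cases hmi : m = i
    · subst hmi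
      simp [Function.update_of_ne hmj, Literature.Analysis.FluidPDE.reflectVel, hω, root,
        Pi.single_apply, hmj, sub_eq_add_neg]
    · simp [Function.update_of_ne hmj, Function.update_of_ne hmi, root, Pi.single_apply, hmi, hmj]

/-- Root norm: `⟪u, u⟫ = 2` for a unit normal and `i ≠ j`. -/
theorem bigInner_root_self {n : ℕ} {i j : Fin n} (hij : i ≠ j) (ω : V3) (hω : ‖ω‖ = 1) :
    bigInner (root i j ω) (root i j ω) = 2 := by
  simp only [bigInner, root, Pi.sub_apply]
  have key : ∀ m : Fin n, ⟪(Pi.single i ω - Pi.single j ω : Fin n → V3) m,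
      (Pi.single i ω - Pi.single j ω : Fin n → V3) m⟫_ℝ =
      (if m = i then 1 else 0) + (if m = j then 1 else 0) := by
    intro m
    by_cases hmi : m = i
    · subst hmi; simp [Pi.single_apply, hij, real_inner_self_eq_norm_sq, hω]
    · by_cases hmj : m = j
      · subst hmj; simp [Pi.single_apply, hmi, real_inner_self_eq_norm_sq, hω]
      · simp [Pi.single_apply, hmi, hmj]
  simp_rw [Pi.sub_apply] at key
  simp_rw [key, Finset.sum_add_distrib, Finset.sum_ite_eq', Finset.mem_univ, if_true]
  norm_num

/-- **Two roots sharing exactly one particle** meet at cosine `⟪ω, ω'⟫ / 2`: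
`⟪e_i⊗ω − e_j⊗ω, e_i⊗ω' − e_l⊗ω'⟫ = ⟪ω, ω'⟫` for pairwise distinct `i, j, l`. (Same pair, two
normals: `2⟪ω, ω'⟫`.) This is where the factor `1/2` that drives the rigidity comes from. -/
theorem bigInner_root_shared {n : ℕ} {i j l : Fin n} (hij : i ≠ j) (hil : i ≠ l) (hjl : j ≠ l)
    (ω ω' : V3) : bigInner (root i j ω) (root i l ω') = ⟪ω, ω'⟫_ℝ := by
  simp only [bigInner, root]
  have key : ∀ m : Fin n, ⟪(Pi.single i ω - Pi.single j ω : Fin n → V3) m,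
      (Pi.single i ω' - Pi.single l ω' : Fin n → V3) m⟫_ℝ =
      if m = i then ⟪ω, ω'⟫_ℝ else 0 := by
    intro m
    by_cases hmi : m = i
    · subst hmi; simp [Pi.single_apply, hij, hil]
    · by_cases hmj : m = j
      · subst hmj; simp [Pi.single_apply, hmi, hjl]
      · by_cases hml : m = l
        · subst hml; simp [Pi.single_apply, hmi, Ne.symm hjl]
        · simp [Pi.single_apply, hmi, hmj, hml]
  simp_rw [key, Finset.sum_ite_eq', Finset.mem_univ, if_true]

/-- Same pair, two normals: `⟪e_i⊗ω − e_j⊗ω, e_i⊗ω' − e_j⊗ω'⟫ = 2⟪ω, ω'⟫`. -/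
theorem bigInner_root_samePair {n : ℕ} {i j : Fin n} (hij : i ≠ j) (ω ω' : V3) :
    bigInner (root i j ω) (root i j ω') = 2 * ⟪ω, ω'⟫_ℝ := by
  simp only [bigInner, root]
  have key : ∀ m : Fin n, ⟪(Pi.single i ω - Pi.single j ω : Fin n → V3) m,
      (Pi.single i ω' - Pi.single j ω' : Fin n → V3) m⟫_ℝ =
      (if m = i then ⟪ω, ω'⟫_ℝ else 0) + (if m = j then ⟪ω, ω'⟫_ℝ else 0) := by
    intro m
    by_cases hmi : m = i
    · subst hmi; simp [Pi.single_apply, hij]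
    · by_cases hmj : m = j
      · subst hmj; simp [Pi.single_apply, hmi]
      · simp [Pi.single_apply, hmi, hmj]
  simp_rw [key, Finset.sum_add_distrib, Finset.sum_ite_eq', Finset.mem_univ, if_true]
  ring

/-- The cosines between distinct, non-opposite roots of a finite IRREDUCIBLE reflection group of
rank `≥ 5` (types `A, B = C, D, E`; no `F₄, H₃, H₄, I₂(m)` above rank 4): `|cos| ∈ {0, 1/2, √2/2}`
(Humphreys 1990, §2.4 Fig. 1 and Theorem 2.7; Bourbaki Lie VI §4). -/
def largeRankCosines : Set ℝ := {0, 1 / 2, -(1 / 2), Real.sqrt 2 / 2, -(Real.sqrt 2 / 2)}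

/-- **The rigidity arithmetic** (PROVED): if two collision normals at a shared particle with distinct
partners make an angle `θ` whose root cosine `cos θ / 2` is a large-rank Coxeter cosine, then
`cos θ ∈ {0, ±1}` — the normals are orthogonal or parallel. (`cos θ = ±√2` and `±1`·2 are excluded by
`|cos θ| ≤ 1 < √2`.) -/
theorem rightAngle_of_coxeter_cosine (c : ℝ) (hc : |c| ≤ 1) (h : c / 2 ∈ largeRankCosines) :
    c = 0 ∨ c = 1 ∨ c = -1 := by
  simp only [largeRankCosines, Set.mem_insert_iff, Set.mem_singleton_iff] at h
  have hs : (1 : ℝ) < Real.sqrt 2 := by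
    rw [show (1 : ℝ) = Real.sqrt 1 by simp]
    exact Real.sqrt_lt_sqrt (by norm_num) (by norm_num)
  rcases h with h | h | h | h | h
  · left; linarith
  · right; left; linarith
  · right; right; linarith
  · exfalso
    have : c = Real.sqrt 2 := by linarith
    rw [this, abs_of_pos (by linarith)] at hc
    linarith
  · exfalso
    have : c = -Real.sqrt 2 := by linarith
    rw [this, abs_neg, abs_of_pos (by linarith)] at hc
    linarith

/-- Householder reflection of a finite-dimensional real inner product space along a unit vector `u`
(reflection in the hyperplane `(ℝ ∙ u)ᗮ`), as a linear isometric equivalence. -/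
def householder {E : Type*} [NormedAddCommGroup E] [InnerProductSpace ℝ E] [FiniteDimensional ℝ E]
    (u : E) : E ≃ₗᵢ[ℝ] E :=
  ((ℝ ∙ u)ᗮ).reflection

/-- **Dihedral finiteness is a rational angle** (classical; Humphreys 1990 §1.1): if the two
reflections along unit vectors `u, u'` generate a finite group, the angle between `u` and `u'` is a
rational multiple of `π`. Cited, to be proved (`s_u s_{u'}` is the rotation by twice the angle). -/
def DihedralFiniteRational : Prop :=
  ∀ (m : ℕ) (u u' : EuclideanSpace ℝ (Fin m)), ‖u‖ = 1 → ‖u'‖ = 1 →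
    (↑(Subgroup.closure ({householder u, householder u'} :
        Set (EuclideanSpace ℝ (Fin m) ≃ₗᵢ[ℝ] EuclideanSpace ℝ (Fin m)))) :
        Set (EuclideanSpace ℝ (Fin m) ≃ₗᵢ[ℝ] EuclideanSpace ℝ (Fin m))).Finite →
    ∃ q : ℚ, Real.arccos ⟪u, u'⟫_ℝ = q * Real.pi

/-- A finite configuration of unit vectors is IRREDUCIBLE if it does not split into two nonempty
mutually orthogonal parts (its Coxeter graph is connected). -/
def IsIrreducibleConfig {E : Type*} [NormedAddCommGroup E] [InnerProductSpace ℝ E]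
    (R : Finset E) : Prop :=
  ∀ A : Finset E, A ⊆ R → A.Nonempty → A ≠ R → ∃ u ∈ A, ∃ u' ∈ R, u' ∉ A ∧ ⟪u, u'⟫_ℝ ≠ 0

/-- **Large-rank restriction** (Humphreys 1990 Theorem 2.7 with §2.4 Fig. 1; Bourbaki Lie VI §4):
if finitely many unit vectors span a space of dimension `≥ 5`, form an irreducible configuration,
and their reflections generate a FINITE group, then any two of them meet at a large-rank Coxeter
cosine (`|⟪u,u'⟫| ∈ {0, 1/2, √2/2}` or `u' = ±u`). Cited fact (unproved here); with
`bigInner_root_shared` and `rightAngle_of_coxeter_cosine` it gives the RIGIDITY THEOREM of the card: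
a connected cluster of `≥ 4` spheres whose normals span `ℝ³` traps the transfer in a finite group
only if at every sphere the normals to distinct partners are pairwise orthogonal or parallel. -/
def LargeRankRootCosines : Prop :=
  ∀ (m : ℕ) (R : Finset (EuclideanSpace ℝ (Fin m))), (∀ u ∈ R, ‖u‖ = 1) →
    IsIrreducibleConfig R →
    5 ≤ Module.finrank ℝ (Submodule.span ℝ (R : Set (EuclideanSpace ℝ (Fin m)))) →
    (↑(Subgroup.closure ((fun u => householder u) '' (R : Set (EuclideanSpace ℝ (Fin m))))) :
        Set (EuclideanSpace ℝ (Fin m) ≃ₗᵢ[ℝ] EuclideanSpace ℝ (Fin m))).Finite →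
    ∀ u ∈ R, ∀ u' ∈ R, u' ≠ u → u' ≠ -u → ⟪u, u'⟫_ℝ ∈ largeRankCosines

/-- **Deterministic shares in a close-packed cage** (the droplet consequence, PROVABLE-NOW algebra):
a rank-one block received along `ω₁` (columns `c_a • ω₁`) hands over, at the next contact with unit
normal `ω₂`, exactly the fraction `⟪ω₁, ω₂⟫²` of its mass: share `= ⟪ω₁,ω₂⟫² ·` mass. For
face-centred-cubic contact normals (`D₃` roots, consecutive bonds at `60°/90°/120°`) the share is
`1/4`, `0` or `3/4`·… — two-sided non-degenerate with `c₀ = 1/4` on every non-orthogonal bond pair,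
with NO randomness of directions. -/
theorem share_of_rankOne (ω₁ ω₂ : V3) (c : Fin 3 → ℝ) :
    ⟪ω₂, gramVec (fun a => c a • ω₁) ω₂⟫_ℝ = ⟪ω₁, ω₂⟫_ℝ ^ 2 * ∑ a, c a ^ 2 := by
  simp only [gramVec, inner_smul_right, real_inner_smul_right, inner_sum, Finset.mul_sum]
  refine Finset.sum_congr rfl fun a _ => ?_
  rw [real_inner_comm ω₁ ω₂]
  ring

end Reflection

end

end Summit.AtomisticToContinuum.HydrodynamicLimit.Cruxes.DiffuseBackwardInfluence.IdeatorTwo
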